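/-
Copyright (c) 2026. All rights reserved.
Released under Apache 2.0 license as described in the file LICENSE.
-/
import Literature.NumberTheory.Weil1964.AdelicThetaDiagonalKernelDelta
import Literature.NumberTheory.Weil1964.AdelicDoublingDiagonalLift
import Literature.NumberTheory.Automorphic.AdelicPiSchwartzBruhatFourier
import HarnessLib

/-!
# Li's diagonal-kernel identity at `δ` in the `Fin (n + n)` currency of the doubling lift, and the
# non-vanishing of `(ω(r_F δ) Φ)(0)`

Topic `NumberTheory/Weil1964`; namespace `Literature.NumberTheory.Weil1964`.  KERNEL MATHEMATICS ONLY
(theorems over existing tree declarations; no `def … : Prop`, no `axiom`, no proof hole).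

`AdelicThetaDiagonalKernelDelta` proves Li's identity [Li1992, (13) pp. 181–182]
`(ω(r_F δ_F) Ψ)(0) = ∫_{𝔸^ι} Ψ(u, u) dν` for Weil's `Θ`-rigid rational lift
`ratThetaLiftContι … (deltaDiag F ι)` on the index type `ι ⊕ ι`, Gram matrix
`doubledGram (T₀ ⊗ 1) = (T₀ ⊗ 1) ⊕ (−T₀ ⊗ 1)`.  The doubling files (`AdelicDoublingDiagonalLift`:
`doubledGramFin`, `doublingDeltaRat`, `doublingDeltaLift`, and downstream the doubled unitary group of
[GelbartRogawski1991, §3.1]) work on the RENUMBERED index `Fin (n + n)` with `ratThetaLiftCont`.  This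
file transports the identity along `e = finSumFinEquiv : Fin n ⊕ Fin n ≃ Fin (n + n)`:

* §0 `adelicMpCont.omega_reindex_apply_zero` (any `e : ι ≃ ι'`):
  `(ω(reindex_e p) Ψ)(0) = (ω(p)(R_e⁻¹ Ψ))(0)`;
* §1 `ratThetaLiftCont_doublingDeltaRat_eq_reindex`: `r_F(δ)` on `Fin (n + n)` IS the reindexing of record
  (`adelicMpContReindex`) of `r_F(δ_F)` on `Fin n ⊕ Fin n` (`Θ`-rigidity: `ratThetaLiftContι_eq_ratLiftVia`),
  hence `omega_ratThetaLiftCont_doublingDeltaRat_apply_zero_eq_deltaDiag`: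
  `(ω(r_F δ) Φ)(0) = (ω(r_F δ_F)(R_e⁻¹ Φ))(0)`;
* §2 `measure_mul_omega_ratThetaLiftCont_doublingDeltaRat_apply_zero`:
  **`ν(D^n) · (ω(r_F δ) Φ)(0) = ∫_{𝔸^n} Φ((u,u) ∘ e⁻¹) dν`** for every additive Haar measure `ν`, every
  `Φ ∈ 𝒮(𝔸^{n+n})`, and ANY Gram matrix `S` propositionally equal to `doubledGramFin F (T₀ ⊗ 1)`
  (hypothesis `hS`, so that consumers whose Gram matrix is only provably of that shape can use it); the
  forms along `R_e = piSBReindex F e`: `… (R_e Ψ) … = ∫ Ψ(u,u) dν`, `… (R_e(φ₁ ⊠ φ̄₂)) … = ∫ φ₁ φ̄₂ dν`;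
* §3 the Tamagawa-normalised statements (`ν(D^n) = 1`, [HarrisKudlaSweet1996, (1.16) p. 952]): general
  `Φ`, the instance `doublingDeltaLift`, `R_e Ψ`, the box forms `R_e(φ₁ ⊠ φ₂)` (`= ∫ φ₁ φ₂`) and
  `R_e(φ₁ ⊠ φ̄₂)` (`= ⟨φ₁, φ₂⟩`);
* §4 **non-vanishing**: `∫ φ φ̄ dν = ‖φ‖²_{L²(ν)} > 0` for `φ ≠ 0` (private helpers: Schwartz–Bruhat
  functions are continuous and integrable; a Haar measure charges non-empty open sets), hence the
  MEASURE-FREE statement `omega_ratThetaLiftCont_doublingDeltaRat_boxConj_apply_zero_ne_zero`: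
  `(ω(r_F δ)(R_e(φ ⊠ φ̄)))(0) ≠ 0` for every `φ ≠ 0` (proved with Mathlib's `Measure.addHaar` on `𝔸_F^n`,
  Borel structure `borel`, second countability ∕ local compactness of `𝔸_F` from `AdelicSecondCountable` ∕
  `AdicCompletionCompact`).  The same for ANY `Φ` whose diagonal restriction is a non-negative real
  function, not identically zero (`…_apply_zero_ne_zero_of_diag_nonneg`: e.g. a real Gaussian times a
  lattice indicator, with no product decomposition of `Φ` needed).
-/

set_option autoImplicit false

noncomputable section

open scoped Matrix ComplexConjugate Classical

namespace Literature.NumberTheory.Weil1964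

open scoped ComplexOrder

open NumberField IsDedekindDomain _root_.MeasureTheory _root_.MeasureTheory.Measure
open Literature.NumberTheory.Automorphic Literature.RepresentationTheory.HeisenbergGroup

section ReindexZero

variable (F : Type) [Field F] [NumberField F] {ι ι' : Type} [Fintype ι] [Fintype ι'] [DecidableEq ι]
  [DecidableEq ι']
  (e : ι ≃ ι') (T : Matrix ι ι (AdeleRing (𝓞 F) F))

/-- **`(ω(reindex_e p) Ψ)(0) = (ω(p)(R_e⁻¹ Ψ))(0)`**: the value at the origin is unchanged by the reindexing
of record (`(R_e Φ)(0) = Φ(0 ∘ e) = Φ(0)`). [cite: GelbartRogawski1991, §3.1 p. 454] -/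
theorem adelicMpCont.omega_reindex_apply_zero (p : adelicMpCont F ι T) (Ψ : piSchwartzBruhat F ι') :
    ((adelicMpCont.omega F ι' (Matrix.reindex e e T) (adelicMpContReindex F e T p) Ψ : piSchwartzBruhat F ι') :
        (ι' → AdeleRing (𝓞 F) F) → ℂ) 0 =
      ((adelicMpCont.omega F ι T p ((piSBReindex F e).symm Ψ) : piSchwartzBruhat F ι) :
        (ι → AdeleRing (𝓞 F) F) → ℂ) 0 := by
  rw [adelicMpCont.omega_reindex_apply]
  rfl

end ReindexZero

section DeltaFin

variable (F : Type) [Field F] [NumberField F] {n : ℕ}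


/-! ## §1 `r_F(δ)` on `Fin (n + n)` is the reindexing of `r_F(δ_F)` on `Fin n ⊕ Fin n` -/

/-- **`r_F(δ) = reindex_e (r_F(δ_F))`**: Weil's `Θ`-rigid lift of `doublingDeltaRat` (Gram matrix
`doubledGramFin F T`, index `Fin (n + n)`) is the reindexing of record along `e = finSumFinEquiv` of the
lift of `deltaDiag F (Fin n)` (Gram matrix `doubledGram T`, index `Fin n ⊕ Fin n`).
[cite: Weil1964, Chap. III n° 40 p. 190, n° 41 Thm 6 p. 193] [cite: Li1992, p. 181] -/
theorem ratThetaLiftCont_doublingDeltaRat_eq_reindex (T : Matrix (Fin n) (Fin n) (AdeleRing (𝓞 F) F))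
    (hT : IsUnit (doubledGram T).det) (hT' : IsUnit (doubledGramFin F T).det) :
    ratThetaLiftCont F (doubledGramFin F T) hT' (doublingDeltaRat F) =
      adelicMpContReindex F finSumFinEquiv (doubledGram T)
        (ratThetaLiftContι F (Fin n ⊕ Fin n) (doubledGram T) hT (deltaDiag F (Fin n))) :=
  (MulEquiv.symm_apply_eq (adelicMpContReindex F finSumFinEquiv (doubledGram T))).1
    (ratThetaLiftContι_eq_ratLiftVia F (Fin n ⊕ Fin n) (doubledGram T) hT finSumFinEquiv
      (deltaDiag F (Fin n))).symm

/-- **`(ω(r_F δ) Φ)(0) = (ω(r_F δ_F)(R_e⁻¹ Φ))(0)`**: the value at the origin in the `Fin (n + n)` currency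
(any Gram matrix `S = doubledGramFin F (T₀ ⊗ 1)`) is the value of Li's `ι ⊕ ι` operator on `R_e⁻¹ Φ`.
[cite: Weil1964, Chap. III n° 41 Thm 6 p. 193] [cite: Li1992, p. 181] -/
theorem omega_ratThetaLiftCont_doublingDeltaRat_apply_zero_eq_deltaDiag
    {S : Matrix (Fin (n + n)) (Fin (n + n)) (AdeleRing (𝓞 F) F)} (T₀ : Matrix (Fin n) (Fin n) F)
    (hT₀ : IsUnit T₀)
    (hS : S = doubledGramFin F (T₀.map (algebraMap F (AdeleRing (𝓞 F) F)))) (hSd : IsUnit S.det)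
    (Φ : piSchwartzBruhat F (Fin (n + n))) :
    ((adelicMpCont.omega F (Fin (n + n)) S (ratThetaLiftCont F S hSd (doublingDeltaRat F)) Φ :
          piSchwartzBruhat F (Fin (n + n))) : (Fin (n + n) → (AdeleRing (𝓞 F) F)) → ℂ) 0 =
      ((adelicMpCont.omega F (Fin n ⊕ Fin n) (doubledGram (T₀.map (algebraMap F (AdeleRing (𝓞 F) F))))
          (ratThetaLiftContι F (Fin n ⊕ Fin n) (doubledGram (T₀.map (algebraMap F (AdeleRing (𝓞 F) F))))
            (isUnit_det_doubledGram T₀ hT₀)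
            (deltaDiag F (Fin n))) ((piSBReindex F finSumFinEquiv).symm Φ) :
          piSchwartzBruhat F (Fin n ⊕ Fin n)) : (Fin n ⊕ Fin n → (AdeleRing (𝓞 F) F)) → ℂ) 0 := by
  subst hS
  exact (congrArg
    (fun q => ((adelicMpCont.omega F (Fin (n + n))
      (doubledGramFin F (T₀.map (algebraMap F (AdeleRing (𝓞 F) F)))) q Φ :
      piSchwartzBruhat F (Fin (n + n))) : (Fin (n + n) → (AdeleRing (𝓞 F) F)) → ℂ) 0)
    (ratThetaLiftCont_doublingDeltaRat_eq_reindex F (T₀.map (algebraMap F (AdeleRing (𝓞 F) F)))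
      (isUnit_det_doubledGram T₀ hT₀) hSd)).trans
    (adelicMpCont.omega_reindex_apply_zero F finSumFinEquiv
      (doubledGram (T₀.map (algebraMap F (AdeleRing (𝓞 F) F))))
      (ratThetaLiftContι F (Fin n ⊕ Fin n) (doubledGram (T₀.map (algebraMap F (AdeleRing (𝓞 F) F))))
        (isUnit_det_doubledGram T₀ hT₀)
        (deltaDiag F (Fin n))) Φ)

/-! ## §2 The value at the origin, any additive Haar measure: `ν(D^n) · (ω(r_F δ) Φ)(0) = ∫ Φ(u^Δ) dν` -/

variable [MeasurableSpace (AdeleRing (𝓞 F) F)] [BorelSpace (AdeleRing (𝓞 F) F)]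
  (ν : Measure (Fin n → AdeleRing (𝓞 F) F)) [ν.IsAddHaarMeasure]

/-- **`ν(D^n) · (ω(r_F δ) Φ)(0) = ∫_{𝔸^n} Φ((u,u) ∘ e⁻¹) dν`** for any additive Haar measure `ν` on `𝔸_F^n`,
any Gram matrix `S = doubledGramFin F (T₀ ⊗ 1)` (`T₀ ∈ GL_n(F)`), any `Φ ∈ 𝒮(𝔸_F^{n+n})`.
[cite: Li1992, (13) pp. 181–182] [cite: Weil1964, Chap. III n° 41 Thm 6 p. 193] -/
theorem measure_mul_omega_ratThetaLiftCont_doublingDeltaRat_apply_zero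
    {S : Matrix (Fin (n + n)) (Fin (n + n)) (AdeleRing (𝓞 F) F)} (T₀ : Matrix (Fin n) (Fin n) F)
    (hT₀ : IsUnit T₀)
    (hS : S = doubledGramFin F (T₀.map (algebraMap F (AdeleRing (𝓞 F) F)))) (hSd : IsUnit S.det)
    (Φ : piSchwartzBruhat F (Fin (n + n))) :
    ((ν (piFundamentalDomain F (Fin n))).toReal : ℂ) *
        ((adelicMpCont.omega F (Fin (n + n)) S (ratThetaLiftCont F S hSd (doublingDeltaRat F)) Φ :
          piSchwartzBruhat F (Fin (n + n))) : (Fin (n + n) → (AdeleRing (𝓞 F) F)) → ℂ) 0 =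
      ∫ u,
        (Φ : (Fin (n + n) → (AdeleRing (𝓞 F) F)) → ℂ) (fun i => Sum.elim u u (finSumFinEquiv.symm i)) ∂ν := by
  rw [omega_ratThetaLiftCont_doublingDeltaRat_apply_zero_eq_deltaDiag F T₀ hT₀ hS hSd]
  refine (measure_mul_omega_ratThetaLiftContι_apply_zero ν T₀ hT₀ (isUnit_det_doubledGram T₀ hT₀)
    (Matrix.fromBlocks 0 T₀ 1 0) (isUnit_fromBlocks_zero_one T₀ ((Matrix.isUnit_iff_isUnit_det _).1 hT₀))
    (deltaDiag F (Fin n)) (fun y => ratSpι_deltaDiag_param F (Fin n) T₀ (isUnit_det_doubledGram T₀ hT₀) y)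
    ((piSBReindex F finSumFinEquiv).symm Φ)).trans (integral_congr_ae (Filter.Eventually.of_forall fun u => ?_))
  dsimp only
  rw [coe_piSBReindex_symm_apply]
  rfl

/-- the same along the renumbering `R_e : 𝒮(𝔸^{n ⊕ n}) ≃ 𝒮(𝔸^{n+n})`:
`ν(D^n) · (ω(r_F δ)(R_e Ψ))(0) = ∫ Ψ(u,u) dν`. [cite: Li1992, (13) pp. 181–182] -/
theorem measure_mul_omega_ratThetaLiftCont_doublingDeltaRat_piSBReindex_apply_zero
    {S : Matrix (Fin (n + n)) (Fin (n + n)) (AdeleRing (𝓞 F) F)} (T₀ : Matrix (Fin n) (Fin n) F)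
    (hT₀ : IsUnit T₀)
    (hS : S = doubledGramFin F (T₀.map (algebraMap F (AdeleRing (𝓞 F) F)))) (hSd : IsUnit S.det)
    (Ψ : piSchwartzBruhat F (Fin n ⊕ Fin n)) :
    ((ν (piFundamentalDomain F (Fin n))).toReal : ℂ) *
        ((adelicMpCont.omega F (Fin (n + n)) S (ratThetaLiftCont F S hSd (doublingDeltaRat F))
          (piSBReindex F finSumFinEquiv Ψ) :
          piSchwartzBruhat F (Fin (n + n))) : (Fin (n + n) → (AdeleRing (𝓞 F) F)) → ℂ) 0 =
      ∫ u, (Ψ : (Fin n ⊕ Fin n → (AdeleRing (𝓞 F) F)) → ℂ) (Sum.elim u u) ∂ν := by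
  rw [measure_mul_omega_ratThetaLiftCont_doublingDeltaRat_apply_zero F ν T₀ hT₀ hS hSd]
  refine integral_congr_ae (Filter.Eventually.of_forall fun u => ?_)
  dsimp only
  rw [coe_piSBReindex_apply]
  exact congrArg (Ψ : (Fin n ⊕ Fin n → (AdeleRing (𝓞 F) F)) → ℂ) (funext fun j => by
    simp only [Function.comp_apply, Equiv.symm_apply_apply])

/-- the same on `R_e(φ₁ ⊠ φ̄₂)`: `ν(D^n) · (ω(r_F δ)(R_e(φ₁ ⊠ φ̄₂)))(0) = ∫ φ₁ φ̄₂ dν`.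
[cite: Li1992, (13) pp. 181–182] -/
theorem measure_mul_omega_ratThetaLiftCont_doublingDeltaRat_boxConj_apply_zero
    {S : Matrix (Fin (n + n)) (Fin (n + n)) (AdeleRing (𝓞 F) F)} (T₀ : Matrix (Fin n) (Fin n) F)
    (hT₀ : IsUnit T₀)
    (hS : S = doubledGramFin F (T₀.map (algebraMap F (AdeleRing (𝓞 F) F)))) (hSd : IsUnit S.det)
    (φ₁ φ₂ : piSchwartzBruhat F (Fin n)) :
    ((ν (piFundamentalDomain F (Fin n))).toReal : ℂ) *
        ((adelicMpCont.omega F (Fin (n + n)) S (ratThetaLiftCont F S hSd (doublingDeltaRat F))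
          (piSBReindex F finSumFinEquiv
            (tensorToSum F (Fin n) (Fin n) φ₁ (piSchwartzBruhatConj F (Fin n) φ₂))) :
          piSchwartzBruhat F (Fin (n + n))) : (Fin (n + n) → (AdeleRing (𝓞 F) F)) → ℂ) 0 =
      ∫ u,
        (φ₁ : (Fin n → (AdeleRing (𝓞 F) F)) → ℂ) u * conj ((φ₂ : (Fin n → (AdeleRing (𝓞 F) F)) → ℂ) u) ∂ν := by
  rw [measure_mul_omega_ratThetaLiftCont_doublingDeltaRat_piSBReindex_apply_zero F ν T₀ hT₀ hS hSd]
  rfl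

/-! ## §3 Tamagawa normalisation `ν(D^n) = 1`: `(ω(r_F δ) Φ)(0) = ∫ Φ(u^Δ) dν` and the box forms -/

/-- **Li's (13) on `Fin (n + n)`: `(ω(r_F δ) Φ)(0) = ∫_{𝔸^n} Φ((u,u) ∘ e⁻¹) dν`** (`c = 1`) for the
Tamagawa-normalised `ν` and any Gram matrix `S = doubledGramFin F (T₀ ⊗ 1)`.
[cite: Li1992, (13) pp. 181–182] [cite: HarrisKudlaSweet1996, (1.16) p. 952] -/
theorem omega_ratThetaLiftCont_doublingDeltaRat_apply_zero
    {S : Matrix (Fin (n + n)) (Fin (n + n)) (AdeleRing (𝓞 F) F)} (T₀ : Matrix (Fin n) (Fin n) F)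
    (hT₀ : IsUnit T₀)
    (hS : S = doubledGramFin F (T₀.map (algebraMap F (AdeleRing (𝓞 F) F)))) (hSd : IsUnit S.det)
    (hν : ν (piFundamentalDomain F (Fin n)) = 1) (Φ : piSchwartzBruhat F (Fin (n + n))) :
    ((adelicMpCont.omega F (Fin (n + n)) S (ratThetaLiftCont F S hSd (doublingDeltaRat F)) Φ :
          piSchwartzBruhat F (Fin (n + n))) : (Fin (n + n) → (AdeleRing (𝓞 F) F)) → ℂ) 0 =
      ∫ u,
        (Φ : (Fin (n + n) → (AdeleRing (𝓞 F) F)) → ℂ) (fun i => Sum.elim u u (finSumFinEquiv.symm i)) ∂ν := by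
  have h1 : ((ν (piFundamentalDomain F (Fin n))).toReal : ℂ) = 1 := by
    rw [hν, ENNReal.toReal_one, Complex.ofReal_one]
  simpa only [h1, one_mul] using
    measure_mul_omega_ratThetaLiftCont_doublingDeltaRat_apply_zero F ν T₀ hT₀ hS hSd Φ

/-- the instance for the doubling lift `doublingDeltaLift F (T₀ ⊗ 1)` of `AdelicDoublingDiagonalLift`:
`(ω(r_F δ) Φ)(0) = ∫ Φ((u,u) ∘ e⁻¹) dν`. [cite: Li1992, (13) pp. 181–182]
[cite: Weil1964, Chap. III n° 40 p. 190] -/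
theorem omega_doublingDeltaLift_apply_zero (T₀ : Matrix (Fin n) (Fin n) F) (hT₀ : IsUnit T₀)
    (hT : IsUnit (T₀.map (algebraMap F (AdeleRing (𝓞 F) F))).det) (hν : ν (piFundamentalDomain F (Fin n)) = 1)
    (Φ : piSchwartzBruhat F (Fin (n + n))) :
    ((adelicMpCont.omega F (Fin (n + n)) (doubledGramFin F (T₀.map (algebraMap F (AdeleRing (𝓞 F) F))))
          (doublingDeltaLift F (T₀.map (algebraMap F (AdeleRing (𝓞 F) F))) hT) Φ :
          piSchwartzBruhat F (Fin (n + n))) : (Fin (n + n) → (AdeleRing (𝓞 F) F)) → ℂ) 0 =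
      ∫ u, (Φ : (Fin (n + n) → (AdeleRing (𝓞 F) F)) → ℂ) (fun i => Sum.elim u u (finSumFinEquiv.symm i)) ∂ν :=
  omega_ratThetaLiftCont_doublingDeltaRat_apply_zero F ν T₀ hT₀ rfl
    (isUnit_det_doubledGramFin F (T₀.map (algebraMap F (AdeleRing (𝓞 F) F))) hT) hν Φ

/-- `(ω(r_F δ)(R_e Ψ))(0) = ∫ Ψ(u,u) dν` for `Ψ ∈ 𝒮(𝔸^{Fin n ⊕ Fin n})`, Tamagawa `ν`.
[cite: Li1992, (13) pp. 181–182] -/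
theorem omega_ratThetaLiftCont_doublingDeltaRat_piSBReindex_apply_zero
    {S : Matrix (Fin (n + n)) (Fin (n + n)) (AdeleRing (𝓞 F) F)} (T₀ : Matrix (Fin n) (Fin n) F)
    (hT₀ : IsUnit T₀)
    (hS : S = doubledGramFin F (T₀.map (algebraMap F (AdeleRing (𝓞 F) F)))) (hSd : IsUnit S.det)
    (hν : ν (piFundamentalDomain F (Fin n)) = 1) (Ψ : piSchwartzBruhat F (Fin n ⊕ Fin n)) :
    ((adelicMpCont.omega F (Fin (n + n)) S (ratThetaLiftCont F S hSd (doublingDeltaRat F))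
      (piSBReindex F finSumFinEquiv Ψ) :
          piSchwartzBruhat F (Fin (n + n))) : (Fin (n + n) → (AdeleRing (𝓞 F) F)) → ℂ) 0 =
      ∫ u, (Ψ : (Fin n ⊕ Fin n → (AdeleRing (𝓞 F) F)) → ℂ) (Sum.elim u u) ∂ν := by
  have h1 : ((ν (piFundamentalDomain F (Fin n))).toReal : ℂ) = 1 := by
    rw [hν, ENNReal.toReal_one, Complex.ofReal_one]
  simpa only [h1, one_mul] using
    measure_mul_omega_ratThetaLiftCont_doublingDeltaRat_piSBReindex_apply_zero F ν T₀ hT₀ hS hSd Ψ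

/-- **box form: `(ω(r_F δ)(R_e(φ₁ ⊠ φ₂)))(0) = ∫ φ₁ φ₂ dν`**, Tamagawa `ν`. [cite: Li1992, (13) pp. 181–182] -/
theorem omega_ratThetaLiftCont_doublingDeltaRat_box_apply_zero
    {S : Matrix (Fin (n + n)) (Fin (n + n)) (AdeleRing (𝓞 F) F)} (T₀ : Matrix (Fin n) (Fin n) F)
    (hT₀ : IsUnit T₀)
    (hS : S = doubledGramFin F (T₀.map (algebraMap F (AdeleRing (𝓞 F) F)))) (hSd : IsUnit S.det)
    (hν : ν (piFundamentalDomain F (Fin n)) = 1) (φ₁ φ₂ : piSchwartzBruhat F (Fin n)) :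
    ((adelicMpCont.omega F (Fin (n + n)) S (ratThetaLiftCont F S hSd (doublingDeltaRat F))
          (piSBReindex F finSumFinEquiv (tensorToSum F (Fin n) (Fin n) φ₁ φ₂)) :
          piSchwartzBruhat F (Fin (n + n))) : (Fin (n + n) → (AdeleRing (𝓞 F) F)) → ℂ) 0 =
      ∫ u, (φ₁ : (Fin n → (AdeleRing (𝓞 F) F)) → ℂ) u * (φ₂ : (Fin n → (AdeleRing (𝓞 F) F)) → ℂ) u ∂ν := by
  rw [omega_ratThetaLiftCont_doublingDeltaRat_piSBReindex_apply_zero F ν T₀ hT₀ hS hSd hν]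
  rfl

/-- **Li's (13) with the conjugate in the second slot:
`(ω(r_F δ)(R_e(φ₁ ⊠ φ̄₂)))(0) = ∫ φ₁ φ̄₂ dν = ⟨φ₁, φ₂⟩`**, Tamagawa `ν`.
[cite: Li1992, (13) pp. 181–182] [cite: HarrisKudlaSweet1996, (1.16) p. 952] -/
theorem omega_ratThetaLiftCont_doublingDeltaRat_boxConj_apply_zero
    {S : Matrix (Fin (n + n)) (Fin (n + n)) (AdeleRing (𝓞 F) F)} (T₀ : Matrix (Fin n) (Fin n) F)
    (hT₀ : IsUnit T₀)
    (hS : S = doubledGramFin F (T₀.map (algebraMap F (AdeleRing (𝓞 F) F)))) (hSd : IsUnit S.det)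
    (hν : ν (piFundamentalDomain F (Fin n)) = 1) (φ₁ φ₂ : piSchwartzBruhat F (Fin n)) :
    ((adelicMpCont.omega F (Fin (n + n)) S (ratThetaLiftCont F S hSd (doublingDeltaRat F))
          (piSBReindex F finSumFinEquiv
            (tensorToSum F (Fin n) (Fin n) φ₁ (piSchwartzBruhatConj F (Fin n) φ₂))) :
          piSchwartzBruhat F (Fin (n + n))) : (Fin (n + n) → (AdeleRing (𝓞 F) F)) → ℂ) 0 =
      ∫ u,
        (φ₁ : (Fin n → (AdeleRing (𝓞 F) F)) → ℂ) u * conj ((φ₂ : (Fin n → (AdeleRing (𝓞 F) F)) → ℂ) u) ∂ν := by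
  rw [omega_ratThetaLiftCont_doublingDeltaRat_piSBReindex_apply_zero F ν T₀ hT₀ hS hSd hν]
  rfl

/-! ## §4 Non-vanishing: `∫ φ φ̄ dν = ‖φ‖² > 0` for `φ ≠ 0` -/

section NormSq

variable {F}

omit [BorelSpace (AdeleRing (𝓞 F) F)] [ν.IsAddHaarMeasure] in
/-- `∫ φ φ̄ dν = ∫ ‖φ‖² dν` (a real number, cast to `ℂ`). [folklore] -/
private theorem piSchwartzBruhat_integral_mul_conj_self_eq (φ : piSchwartzBruhat F (Fin n)) :
    ∫ u, (φ : (Fin n → (AdeleRing (𝓞 F) F)) → ℂ) u * conj ((φ : (Fin n → (AdeleRing (𝓞 F) F)) → ℂ) u) ∂ν =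
      ((∫ u, ‖(φ : (Fin n → (AdeleRing (𝓞 F) F)) → ℂ) u‖ ^ 2 ∂ν : ℝ) : ℂ) := by
  rw [← integral_complex_ofReal]
  refine integral_congr_ae (Filter.Eventually.of_forall fun u => ?_)
  simp only [Complex.mul_conj, Complex.normSq_eq_norm_sq, Complex.ofReal_pow]

/-- **`‖φ‖²_{L²(ν)} > 0` for a non-zero Schwartz–Bruhat function** (continuous and integrable; an additive
Haar measure charges non-empty open sets). [folklore] -/
private theorem piSchwartzBruhat_integral_norm_sq_pos (φ : piSchwartzBruhat F (Fin n)) (hφ : φ ≠ 0) :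
    0 < ∫ u, ‖(φ : (Fin n → (AdeleRing (𝓞 F) F)) → ℂ) u‖ ^ 2 ∂ν := by
  have hne : ((φ : (Fin n → (AdeleRing (𝓞 F) F)) → ℂ)) ≠ 0 := fun h => hφ (Subtype.ext h)
  obtain ⟨x, hx⟩ := Function.ne_iff.1 hne
  have hc : Continuous fun u => ‖(φ : (Fin n → (AdeleRing (𝓞 F) F)) → ℂ) u‖ ^ 2 :=
    (continuous_of_mem_piSchwartzBruhat φ.2).norm.pow 2
  have hi : Integrable (fun u => ‖(φ : (Fin n → (AdeleRing (𝓞 F) F)) → ℂ) u‖ ^ 2) ν := by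
    have h := (integrable_of_mem_piSchwartzBruhat (ν := ν) (diag_mem_piSchwartzBruhat
      (tensorToSum F (Fin n) (Fin n) φ (piSchwartzBruhatConj F (Fin n) φ)).2)).norm
    refine h.congr (Filter.Eventually.of_forall fun u => ?_)
    show ‖(φ : (Fin n → (AdeleRing (𝓞 F) F)) → ℂ) u * conj ((φ : (Fin n → (AdeleRing (𝓞 F) F)) → ℂ) u)‖ =
      ‖(φ : (Fin n → (AdeleRing (𝓞 F) F)) → ℂ) u‖ ^ 2
    rw [norm_mul, Complex.norm_conj, sq]
  exact integral_pos_of_integrable_nonneg_nonzero hc hi (fun u => sq_nonneg _)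
    (pow_ne_zero 2 (norm_ne_zero_iff.2 hx))

/-- `∫ φ φ̄ dν ≠ 0` for `φ ≠ 0`. [folklore] -/
private theorem piSchwartzBruhat_integral_mul_conj_self_ne_zero (φ : piSchwartzBruhat F (Fin n)) (hφ : φ ≠ 0) :
    ∫ u,
      (φ : (Fin n → (AdeleRing (𝓞 F) F)) → ℂ) u * conj ((φ : (Fin n → (AdeleRing (𝓞 F) F)) → ℂ) u) ∂ν ≠ 0 := by
  rw [piSchwartzBruhat_integral_mul_conj_self_eq ν φ, Ne, Complex.ofReal_eq_zero]
  exact (piSchwartzBruhat_integral_norm_sq_pos ν φ hφ).ne'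

/-- `∫ Φ(u^Δ) dν ≠ 0` as soon as the diagonal restriction `u ↦ Φ((u,u) ∘ e⁻¹)` (a Schwartz–Bruhat function
on `𝔸_F^n`, hence continuous and integrable) is a non-negative real function that is not identically
zero. [folklore] -/
private theorem integral_diag_ne_zero_of_nonneg (Φ : piSchwartzBruhat F (Fin (n + n)))
    (h0 : ∀ u : Fin n → AdeleRing (𝓞 F) F,
      0 ≤ (Φ : (Fin (n + n) → AdeleRing (𝓞 F) F) → ℂ) (fun i => Sum.elim u u (finSumFinEquiv.symm i)))
    (hne : ∃ u : Fin n → AdeleRing (𝓞 F) F,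
      (Φ : (Fin (n + n) → AdeleRing (𝓞 F) F) → ℂ) (fun i => Sum.elim u u (finSumFinEquiv.symm i)) ≠ 0) :
    ∫ u, (Φ : (Fin (n + n) → AdeleRing (𝓞 F) F) → ℂ) (fun i => Sum.elim u u (finSumFinEquiv.symm i)) ∂ν
      ≠ 0 := by
  set g : (Fin n → AdeleRing (𝓞 F) F) → ℂ :=
    fun u => (Φ : (Fin (n + n) → AdeleRing (𝓞 F) F) → ℂ) (fun i => Sum.elim u u (finSumFinEquiv.symm i))
    with hg_def
  have hg : g ∈ piSchwartzBruhat F (Fin n) := by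
    rw [hg_def]
    exact diag_mem_piSchwartzBruhat ((piSBReindex F finSumFinEquiv).symm Φ).2
  have him : ∀ u, (g u).im = 0 := fun u => (Complex.le_def.1 (h0 u)).2.symm.trans Complex.zero_im
  have hre : ∀ u, 0 ≤ (g u).re := fun u => by
    have h := (Complex.le_def.1 (h0 u)).1
    rwa [Complex.zero_re] at h
  have hg_eq : ∀ u, g u = ((g u).re : ℂ) := fun u =>
    Complex.ext (by rw [Complex.ofReal_re]) (by rw [Complex.ofReal_im, him u])
  obtain ⟨x, hx⟩ := hne
  have hx' : (g x).re ≠ 0 := fun h =>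
    hx (Complex.ext (h.trans Complex.zero_re.symm) ((him x).trans Complex.zero_im.symm))
  have hpos : 0 < ∫ u, (g u).re ∂ν :=
    integral_pos_of_integrable_nonneg_nonzero
      (Complex.continuous_re.comp (continuous_of_mem_piSchwartzBruhat hg))
      (integrable_of_mem_piSchwartzBruhat hg).re (fun u => hre u) hx'
  rw [show (∫ u, g u ∂ν) = ((∫ u, (g u).re ∂ν : ℝ) : ℂ) by
    rw [← integral_complex_ofReal]
    exact integral_congr_ae (Filter.Eventually.of_forall hg_eq)]
  exact Complex.ofReal_ne_zero.2 hpos.ne'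

end NormSq

/-- `ν(D^n) · (ω(r_F δ)(R_e(φ ⊠ φ̄)))(0) ≠ 0` for `φ ≠ 0`, any additive Haar measure `ν`.
[cite: Li1992, (13) pp. 181–182] -/
theorem measure_mul_omega_ratThetaLiftCont_doublingDeltaRat_boxConj_apply_zero_ne_zero
    {S : Matrix (Fin (n + n)) (Fin (n + n)) (AdeleRing (𝓞 F) F)} (T₀ : Matrix (Fin n) (Fin n) F)
    (hT₀ : IsUnit T₀)
    (hS : S = doubledGramFin F (T₀.map (algebraMap F (AdeleRing (𝓞 F) F)))) (hSd : IsUnit S.det)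
    (φ : piSchwartzBruhat F (Fin n)) (hφ : φ ≠ 0) :
    ((ν (piFundamentalDomain F (Fin n))).toReal : ℂ) *
        ((adelicMpCont.omega F (Fin (n + n)) S (ratThetaLiftCont F S hSd (doublingDeltaRat F))
          (piSBReindex F finSumFinEquiv (tensorToSum F (Fin n) (Fin n) φ (piSchwartzBruhatConj F (Fin n) φ))) :
          piSchwartzBruhat F (Fin (n + n))) : (Fin (n + n) → (AdeleRing (𝓞 F) F)) → ℂ) 0 ≠ 0 := by
  rw [measure_mul_omega_ratThetaLiftCont_doublingDeltaRat_boxConj_apply_zero F ν T₀ hT₀ hS hSd]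
  exact piSchwartzBruhat_integral_mul_conj_self_ne_zero ν φ hφ

/-- `ν(D^n) · (ω(r_F δ) Φ)(0) ≠ 0` as soon as the diagonal restriction `u ↦ Φ((u,u) ∘ e⁻¹)` is a
non-negative real function, not identically zero (e.g. a Gaussian times the indicator of a lattice: no
product decomposition of `Φ` is needed). [cite: Li1992, (13) pp. 181–182] -/
theorem measure_mul_omega_ratThetaLiftCont_doublingDeltaRat_apply_zero_ne_zero_of_diag_nonneg
    {S : Matrix (Fin (n + n)) (Fin (n + n)) (AdeleRing (𝓞 F) F)} (T₀ : Matrix (Fin n) (Fin n) F)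
    (hT₀ : IsUnit T₀)
    (hS : S = doubledGramFin F (T₀.map (algebraMap F (AdeleRing (𝓞 F) F)))) (hSd : IsUnit S.det)
    (Φ : piSchwartzBruhat F (Fin (n + n)))
    (h0 : ∀ u : Fin n → AdeleRing (𝓞 F) F,
      0 ≤ (Φ : (Fin (n + n) → AdeleRing (𝓞 F) F) → ℂ) (fun i => Sum.elim u u (finSumFinEquiv.symm i)))
    (hne : ∃ u : Fin n → AdeleRing (𝓞 F) F,
      (Φ : (Fin (n + n) → AdeleRing (𝓞 F) F) → ℂ) (fun i => Sum.elim u u (finSumFinEquiv.symm i)) ≠ 0) :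
    ((ν (piFundamentalDomain F (Fin n))).toReal : ℂ) *
        ((adelicMpCont.omega F (Fin (n + n)) S (ratThetaLiftCont F S hSd (doublingDeltaRat F)) Φ :
          piSchwartzBruhat F (Fin (n + n))) : (Fin (n + n) → (AdeleRing (𝓞 F) F)) → ℂ) 0 ≠ 0 := by
  rw [measure_mul_omega_ratThetaLiftCont_doublingDeltaRat_apply_zero F ν T₀ hT₀ hS hSd]
  exact integral_diag_ne_zero_of_nonneg ν Φ h0 hne

end DeltaFin

/-! ### The measure-free non-vanishing statement -/

section DeltaFinNonvanishing

variable (F : Type) [Field F] [NumberField F] {n : ℕ}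


/-- **NON-VANISHING OF THE DOUBLED VACUUM VALUE: `(ω(r_F δ)(R_e(φ ⊠ φ̄)))(0) ≠ 0` for every `φ ≠ 0`**, for
any Gram matrix `S = doubledGramFin F (T₀ ⊗ 1)`; no measure in the statement (internally:
`ν(D^n) · value = ‖φ‖²_{L²(ν)} > 0` for Mathlib's `addHaar` on `𝔸_F^n` with its Borel structure).
[cite: Li1992, (13) pp. 181–182] [cite: Weil1964, Chap. III n° 41 Thm 6 p. 193] -/
theorem omega_ratThetaLiftCont_doublingDeltaRat_boxConj_apply_zero_ne_zero
    {S : Matrix (Fin (n + n)) (Fin (n + n)) (AdeleRing (𝓞 F) F)} (T₀ : Matrix (Fin n) (Fin n) F)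
    (hT₀ : IsUnit T₀)
    (hS : S = doubledGramFin F (T₀.map (algebraMap F (AdeleRing (𝓞 F) F)))) (hSd : IsUnit S.det)
    (φ : piSchwartzBruhat F (Fin n)) (hφ : φ ≠ 0) :
    ((adelicMpCont.omega F (Fin (n + n)) S (ratThetaLiftCont F S hSd (doublingDeltaRat F))
          (piSBReindex F finSumFinEquiv (tensorToSum F (Fin n) (Fin n) φ (piSchwartzBruhatConj F (Fin n) φ))) :
          piSchwartzBruhat F (Fin (n + n))) : (Fin (n + n) → (AdeleRing (𝓞 F) F)) → ℂ) 0 ≠ 0 := by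
  letI : MeasurableSpace (AdeleRing (𝓞 F) F) := borel (AdeleRing (𝓞 F) F)
  haveI : BorelSpace (AdeleRing (𝓞 F) F) := ⟨rfl⟩
  haveI : SecondCountableTopology (AdeleRing (𝓞 F) F) := secondCountableTopology_adeleRing F
  haveI : LocallyCompactSpace (AdeleRing (𝓞 F) F) := locallyCompactSpace_adeleRing' F
  haveI : BorelSpace (Fin n → (AdeleRing (𝓞 F) F)) := Pi.borelSpace
  intro h0
  have h := measure_mul_omega_ratThetaLiftCont_doublingDeltaRat_boxConj_apply_zero_ne_zero F
    (Measure.addHaar : Measure (Fin n → (AdeleRing (𝓞 F) F))) T₀ hT₀ hS hSd φ hφ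
  rw [h0, mul_zero] at h
  exact h rfl

/-- the instance for `doublingDeltaLift F (T₀ ⊗ 1)`: `(ω(r_F δ)(R_e(φ ⊠ φ̄)))(0) ≠ 0` for `φ ≠ 0`.
[cite: Li1992, (13) pp. 181–182] [cite: Weil1964, Chap. III n° 40 p. 190] -/
theorem omega_doublingDeltaLift_boxConj_apply_zero_ne_zero (T₀ : Matrix (Fin n) (Fin n) F) (hT₀ : IsUnit T₀)
    (hT : IsUnit (T₀.map (algebraMap F (AdeleRing (𝓞 F) F))).det) (φ : piSchwartzBruhat F (Fin n))
    (hφ : φ ≠ 0) :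
    ((adelicMpCont.omega F (Fin (n + n)) (doubledGramFin F (T₀.map (algebraMap F (AdeleRing (𝓞 F) F))))
          (doublingDeltaLift F (T₀.map (algebraMap F (AdeleRing (𝓞 F) F))) hT)
          (piSBReindex F finSumFinEquiv (tensorToSum F (Fin n) (Fin n) φ (piSchwartzBruhatConj F (Fin n) φ))) :
          piSchwartzBruhat F (Fin (n + n))) : (Fin (n + n) → (AdeleRing (𝓞 F) F)) → ℂ) 0 ≠ 0 :=
  omega_ratThetaLiftCont_doublingDeltaRat_boxConj_apply_zero_ne_zero F T₀ hT₀ rfl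
    (isUnit_det_doubledGramFin F (T₀.map (algebraMap F (AdeleRing (𝓞 F) F))) hT) φ hφ

/-- **`(ω(r_F δ) Φ)(0) ≠ 0` whenever the diagonal restriction `u ↦ Φ((u,u) ∘ e⁻¹)` is a non-negative real
function, not identically zero** (no measure in the statement; covers the doubled vacuum directly: a
real Gaussian at the archimedean places times a lattice indicator at the finite ones is `> 0` at `u = 0`
and `≥ 0` on the diagonal). [cite: Li1992, (13) pp. 181–182]
[cite: Weil1964, Chap. III n° 41 Thm 6 p. 193] -/
theorem omega_ratThetaLiftCont_doublingDeltaRat_apply_zero_ne_zero_of_diag_nonneg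
    {S : Matrix (Fin (n + n)) (Fin (n + n)) (AdeleRing (𝓞 F) F)} (T₀ : Matrix (Fin n) (Fin n) F)
    (hT₀ : IsUnit T₀)
    (hS : S = doubledGramFin F (T₀.map (algebraMap F (AdeleRing (𝓞 F) F)))) (hSd : IsUnit S.det)
    (Φ : piSchwartzBruhat F (Fin (n + n)))
    (h0 : ∀ u : Fin n → AdeleRing (𝓞 F) F,
      0 ≤ (Φ : (Fin (n + n) → AdeleRing (𝓞 F) F) → ℂ) (fun i => Sum.elim u u (finSumFinEquiv.symm i)))
    (hne : ∃ u : Fin n → AdeleRing (𝓞 F) F,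
      (Φ : (Fin (n + n) → AdeleRing (𝓞 F) F) → ℂ) (fun i => Sum.elim u u (finSumFinEquiv.symm i)) ≠ 0) :
    ((adelicMpCont.omega F (Fin (n + n)) S (ratThetaLiftCont F S hSd (doublingDeltaRat F)) Φ :
          piSchwartzBruhat F (Fin (n + n))) : (Fin (n + n) → (AdeleRing (𝓞 F) F)) → ℂ) 0 ≠ 0 := by
  letI : MeasurableSpace (AdeleRing (𝓞 F) F) := borel (AdeleRing (𝓞 F) F)
  haveI : BorelSpace (AdeleRing (𝓞 F) F) := ⟨rfl⟩
  haveI : SecondCountableTopology (AdeleRing (𝓞 F) F) := secondCountableTopology_adeleRing F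
  haveI : LocallyCompactSpace (AdeleRing (𝓞 F) F) := locallyCompactSpace_adeleRing' F
  haveI : BorelSpace (Fin n → (AdeleRing (𝓞 F) F)) := Pi.borelSpace
  intro h
  have h' := measure_mul_omega_ratThetaLiftCont_doublingDeltaRat_apply_zero_ne_zero_of_diag_nonneg F
    (Measure.addHaar : Measure (Fin n → (AdeleRing (𝓞 F) F))) T₀ hT₀ hS hSd Φ h0 hne
  rw [h, mul_zero] at h'
  exact h' rfl

/-- the instance for `doublingDeltaLift F (T₀ ⊗ 1)`: `(ω(r_F δ) Φ)(0) ≠ 0` for `Φ` with non-negative real,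
not identically zero, diagonal restriction. [cite: Li1992, (13) pp. 181–182]
[cite: Weil1964, Chap. III n° 40 p. 190] -/
theorem omega_doublingDeltaLift_apply_zero_ne_zero_of_diag_nonneg (T₀ : Matrix (Fin n) (Fin n) F)
    (hT₀ : IsUnit T₀) (hT : IsUnit (T₀.map (algebraMap F (AdeleRing (𝓞 F) F))).det)
    (Φ : piSchwartzBruhat F (Fin (n + n)))
    (h0 : ∀ u : Fin n → AdeleRing (𝓞 F) F,
      0 ≤ (Φ : (Fin (n + n) → AdeleRing (𝓞 F) F) → ℂ) (fun i => Sum.elim u u (finSumFinEquiv.symm i)))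
    (hne : ∃ u : Fin n → AdeleRing (𝓞 F) F,
      (Φ : (Fin (n + n) → AdeleRing (𝓞 F) F) → ℂ) (fun i => Sum.elim u u (finSumFinEquiv.symm i)) ≠ 0) :
    ((adelicMpCont.omega F (Fin (n + n)) (doubledGramFin F (T₀.map (algebraMap F (AdeleRing (𝓞 F) F))))
          (doublingDeltaLift F (T₀.map (algebraMap F (AdeleRing (𝓞 F) F))) hT) Φ :
          piSchwartzBruhat F (Fin (n + n))) : (Fin (n + n) → (AdeleRing (𝓞 F) F)) → ℂ) 0 ≠ 0 :=
  omega_ratThetaLiftCont_doublingDeltaRat_apply_zero_ne_zero_of_diag_nonneg F T₀ hT₀ rfl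
    (isUnit_det_doubledGramFin F (T₀.map (algebraMap F (AdeleRing (𝓞 F) F))) hT) Φ h0 hne

end DeltaFinNonvanishing

end Literature.NumberTheory.Weil1964
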